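import Mathlib
import Literature.ModelTheory.ExponentialFields.SemialgebraicInterior
import Summits.KontsevichZagierPeriods.KontsevichZagierPeriods.Theorems.InverseLandauTateFamilyKernelStubLinDensity

/-!
# Crux `TateFamilyKernel` (stmt-KontsevichZagierPeriods-9130), line `Sketch`: `stub_gpDensity`

Step GP2 (PUSHFORWARD DENSITY, TOP INTERVAL) of the graph-pencil class
`Q = 1 − ϖ(u(z₂) + βz₁)`, `u ∈ ℚ[s]` strictly increasing on `[0,1]`, `0 < β`, numerator
`P ∈ ℚ[z₁,z₂]` arbitrary, in the lead's skeleton for the crux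
`Summit.KontsevichZagierPeriods.KontsevichZagierPeriods.Theses.InverseLandau.TateFamilyKernel`.

Write `U(s) = u(s)` (a real polynomial function), `T(z) = U(z₂) + βz₁ : (0,1)² → (U(0), U(1)+β)`
and `P̂(y,σ) = P((y − U(σ))/β, σ)`.  If every polynomial test function of `T` integrates to zero
against `P` on the open unit square, then for every `s ∈ (0,1)` with `U(s) > U(1) − β` the
single-branch identity `∫_{σ ∈ (s,1)} P̂(U(s)+β, σ) dσ = 0` holds.  Proof, all in Mathlib's
measure theory and following the linear class (`…Descent.LinDensity`):

1. the EXTENDED INVERSE `e : ℝ → [0,1]` of `U|[0,1]` (`GpDensity.exists_extendedInverse`):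
   extend `U|[0,1]` to the strictly increasing continuous bijection
   `V(r) = U(c(r)) + (r − c(r))` of `ℝ` (`c` = projection onto `[0,1]`), invert it as an order
   isomorphism (`StrictMono.orderIsoOfSurjective`, continuous by `OrderIso.continuous`) and
   project back onto `[0,1]`; then `{σ ∈ (0,1) : y − β < U(σ) < y} = (e(y−β), e(y))`;
2. transport the square integral to `ℝ × ℝ`, `σ = z₂` outside
   (`LinDensity.setIntegral_pi_Ioo_fin_two`, `LinDensity.setIntegral_Ioo_prod_Ioo_symm`),
   substitute `y = U(σ) + βz₁` in the inner integral
   and extend by zero to `y ∈ (U(0), U(1)+β)`, swap (`LinDensity.setIntegral_setIntegral_swap`):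
   `∫_□ g(T) P = ∫ g(y) Φ(y) dy` with the density `Φ(y) = β⁻¹ ∫_{e(y−β)}^{e(y)} P̂(y,σ) dσ`;
3. `Φ` is continuous on `ℝ` (proper parametric integral with continuously moving endpoints), and
   orthogonal to all polynomials on `(U(0), U(1)+β)`, hence zero there (Weierstrass, in the form
   `LinDensity.eq_zero_of_forall_moment_eq_zero` after a translation);
4. at `y = U(s) + β` one has `e(y − β) = s`, `e(y) = 1`, whence the claim.

References: Kontsevich–Zagier 2001, §1.2 (an elementary real-analysis step of one test class of
the period conjecture).  Mathlib plus
`Literature.ModelTheory.ExponentialFields.continuous_aeval_real` and the `LinDensity` helpers; no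
named fact, no new definition.  Helpers live in the sub-namespace `GpDensity`.
-/

noncomputable section

open MeasureTheory Set MvPolynomial
open Literature.ModelTheory.ExponentialFields (continuous_aeval_real)

namespace Summit.KontsevichZagierPeriods.InverseLandau.TateFamilyKernel.Descent

namespace GpDensity

/-! ### The extended inverse of a strictly increasing continuous function on `[0,1]` -/

/-- **Extended inverse.** A continuous `U : ℝ → ℝ`, strictly increasing on `[0,1]`, has a
continuous monotone "clamped inverse" `e : ℝ → [0,1]`: `e(U σ) = σ` on `[0,1]`, `e = 1` on
`[U 1, ∞)`, and for `σ ∈ (0,1)` and every real `t`: `U σ < t ↔ σ < e t`, `t < U σ ↔ e t < σ`.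
Construction: `e = c ∘ V⁻¹` where `c = max 0 ∘ min 1` is the projection onto `[0,1]` and
`V r = U (c r) + (r − c r)` is a strictly increasing continuous bijection of `ℝ` extending
`U|[0,1]`, inverted by `StrictMono.orderIsoOfSurjective` (continuous: `OrderIso.continuous`).
[folklore] -/
theorem exists_extendedInverse {U : ℝ → ℝ} (hU : Continuous U)
    (hmono : StrictMonoOn U (Icc (0 : ℝ) 1)) :
    ∃ e : ℝ → ℝ, Continuous e ∧ Monotone e ∧ (∀ t, e t ∈ Icc (0 : ℝ) 1) ∧
      (∀ σ ∈ Icc (0 : ℝ) 1, e (U σ) = σ) ∧ (∀ t, U 1 ≤ t → e t = 1) ∧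
      (∀ σ ∈ Ioo (0 : ℝ) 1, ∀ t, (U σ < t ↔ σ < e t) ∧ (t < U σ ↔ e t < σ)) := by
  -- the projection `c` onto `[0,1]`
  obtain ⟨c, hc_def⟩ : ∃ c : ℝ → ℝ, c = fun r => max 0 (min 1 r) := ⟨_, rfl⟩
  have hc_mem : ∀ r, c r ∈ Icc (0 : ℝ) 1 := fun r => by
    rw [hc_def]
    exact ⟨le_max_left _ _, max_le zero_le_one (min_le_left _ _)⟩
  have hc_id : ∀ r ∈ Icc (0 : ℝ) 1, c r = r := fun r hr => by
    rw [hc_def]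
    show max 0 (min 1 r) = r
    rw [min_eq_right hr.2, max_eq_right hr.1]
  have hc_mono : Monotone c := fun r t h => by
    rw [hc_def]
    exact max_le_max le_rfl (min_le_min le_rfl h)
  have hc_sub : ∀ r t, r ≤ t → c t ≤ c r + (t - r) := fun r t h => by
    rw [hc_def]
    show max 0 (min 1 t) ≤ max 0 (min 1 r) + (t - r)
    calc max 0 (min 1 t) ≤ max (0 + (t - r)) (min 1 r + (t - r)) :=
          max_le_max (by linarith) (by
            rw [← min_add_add_right]
            exact min_le_min (by linarith) (by linarith))
      _ = max 0 (min 1 r) + (t - r) := max_add_add_right 0 (min 1 r) (t - r)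
  have hc_cont : Continuous c := by
    rw [hc_def]
    exact continuous_const.max (continuous_const.min continuous_id)
  have h01 : (0 : ℝ) ∈ Icc (0 : ℝ) 1 := left_mem_Icc.2 zero_le_one
  have h11 : (1 : ℝ) ∈ Icc (0 : ℝ) 1 := right_mem_Icc.2 zero_le_one
  -- the strictly increasing continuous bijection `V` of `ℝ` extending `U|[0,1]`
  obtain ⟨V, hV_def⟩ : ∃ V : ℝ → ℝ, V = fun r => U (c r) + (r - c r) := ⟨_, rfl⟩
  have hV_eq : ∀ r ∈ Icc (0 : ℝ) 1, V r = U r := fun r hr => by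
    rw [hV_def]
    show U (c r) + (r - c r) = U r
    rw [hc_id r hr, sub_self, add_zero]
  have hV_mono : StrictMono V := fun r t hrt => by
    rw [hV_def]
    show U (c r) + (r - c r) < U (c t) + (t - c t)
    have h1 := hc_sub r t hrt.le
    rcases (hc_mono hrt.le).lt_or_eq with hlt | heq
    · have h2 := hmono (hc_mem r) (hc_mem t) hlt
      linarith
    · rw [heq]
      linarith
  have hV_cont : Continuous V := by
    rw [hV_def]
    exact (hU.comp hc_cont).add (continuous_id.sub hc_cont)
  have hV_surj : Function.Surjective V := by
    refine hV_cont.surjective ?_ ?_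
    · have hlow : ∀ r, U 0 - 1 + r ≤ V r := fun r => by
        have h := hmono.monotoneOn h01 (hc_mem r) (hc_mem r).1
        rw [hV_def]
        show U 0 - 1 + r ≤ U (c r) + (r - c r)
        linarith [(hc_mem r).2]
      exact Filter.tendsto_atTop_mono hlow
        (Filter.tendsto_atTop_add_const_left _ (U 0 - 1) Filter.tendsto_id)
    · have hupp : ∀ r, V r ≤ U 1 + r := fun r => by
        have h := hmono.monotoneOn (hc_mem r) h11 (hc_mem r).2
        rw [hV_def]
        show U (c r) + (r - c r) ≤ U 1 + r
        linarith [(hc_mem r).1]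
      exact Filter.tendsto_atBot_mono hupp
        (Filter.tendsto_atBot_add_const_left _ (U 1) Filter.tendsto_id)
  -- its inverse `E`, an order isomorphism, hence continuous
  have hEV : ∀ r, (hV_mono.orderIsoOfSurjective V hV_surj).symm (V r) = r :=
    hV_mono.orderIsoOfSurjective_symm_apply_self V hV_surj
  have hlt_iff : ∀ r t, V r < t ↔ r < (hV_mono.orderIsoOfSurjective V hV_surj).symm t :=
    fun r t => by rw [OrderIso.lt_symm_apply, StrictMono.coe_orderIsoOfSurjective]
  have hgt_iff : ∀ r t, t < V r ↔ (hV_mono.orderIsoOfSurjective V hV_surj).symm t < r :=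
    fun r t => by rw [OrderIso.symm_apply_lt, StrictMono.coe_orderIsoOfSurjective]
  have hle_iff : ∀ r t, V r ≤ t ↔ r ≤ (hV_mono.orderIsoOfSurjective V hV_surj).symm t :=
    fun r t => by rw [OrderIso.le_symm_apply, StrictMono.coe_orderIsoOfSurjective]
  have hE_cont : Continuous (hV_mono.orderIsoOfSurjective V hV_surj).symm :=
    (hV_mono.orderIsoOfSurjective V hV_surj).symm.continuous
  have hE_mono : Monotone (hV_mono.orderIsoOfSurjective V hV_surj).symm :=
    (hV_mono.orderIsoOfSurjective V hV_surj).symm.monotone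
  set E := (hV_mono.orderIsoOfSurjective V hV_surj).symm with hE
  refine ⟨fun t => c (E t), hc_cont.comp hE_cont, hc_mono.comp hE_mono, fun t => hc_mem _,
    fun σ hσ => ?_, fun t ht => ?_, fun σ hσ t => ⟨?_, ?_⟩⟩
  · show c (E (U σ)) = σ
    rw [← hV_eq σ hσ, hEV, hc_id σ hσ]
  · show c (E t) = 1
    have h1 : 1 ≤ E t := (hle_iff 1 t).1 (by rwa [hV_eq 1 h11])
    rw [hc_def]
    show max 0 (min 1 (E t)) = 1
    rw [min_eq_left h1, max_eq_right zero_le_one]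
  · show U σ < t ↔ σ < c (E t)
    rw [← hV_eq σ (Ioo_subset_Icc_self hσ), hlt_iff, hc_def]
    show σ < E t ↔ σ < max 0 (min 1 (E t))
    rw [lt_max_iff, lt_min_iff]
    constructor
    · exact fun h => Or.inr ⟨hσ.2, h⟩
    · rintro (h | ⟨-, h⟩)
      · exact absurd h (not_lt.2 hσ.1.le)
      · exact h
  · show t < U σ ↔ c (E t) < σ
    rw [← hV_eq σ (Ioo_subset_Icc_self hσ), hgt_iff, hc_def]
    show E t < σ ↔ max 0 (min 1 (E t)) < σ
    rw [max_lt_iff, min_lt_iff]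
    constructor
    · exact fun h => ⟨hσ.1, Or.inr h⟩
    · rintro ⟨-, h | h⟩
      · exact absurd h (not_lt.2 hσ.2.le)
      · exact h

/-! ### One-dimensional substitution and translated Weierstrass -/

/-- The affine substitution `y = c + b·x` (`0 < b`) in an integral over `x ∈ (0,1)`, with the new
integrand extended by zero from `(c, c+b)` to a larger interval `(A, B)`:
`∫_{(0,1)} f = ∫_{y ∈ (A,B)} 𝟙_{c<y<c+b} b⁻¹ f((y−c)/b)`; no hypothesis on `f`. [folklore] -/
theorem setIntegral_Ioo_unit_comp_affine (f : ℝ → ℝ) {b : ℝ} (hb : 0 < b) (c : ℝ) {A B : ℝ}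
    (hA : A ≤ c) (hB : c + b ≤ B) :
    ∫ x in Ioo (0 : ℝ) 1, f x =
      ∫ y in Ioo A B, (Ioo c (c + b)).indicator (fun y => b⁻¹ * f ((y - c) / b)) y := by
  have hsub : ∫ y in c..c + b, f ((y - c) / b) = b * ∫ x in (0 : ℝ)..1, f x := by
    have h := intervalIntegral.integral_comp_sub_right (fun x => f (x / b)) c (a := c) (b := c + b)
    simp only [sub_self, add_sub_cancel_left] at h
    rw [h, intervalIntegral.integral_comp_div _ hb.ne', zero_div, div_self hb.ne', smul_eq_mul]
  calc ∫ x in Ioo (0 : ℝ) 1, f x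
      = ∫ x in (0 : ℝ)..1, f x := by
        rw [intervalIntegral.integral_of_le zero_le_one, integral_Ioc_eq_integral_Ioo]
    _ = ∫ y in c..c + b, b⁻¹ * f ((y - c) / b) := by
        rw [intervalIntegral.integral_const_mul, hsub, ← mul_assoc, inv_mul_cancel₀ hb.ne', one_mul]
    _ = ∫ y in Ioo c (c + b), b⁻¹ * f ((y - c) / b) := by
        rw [intervalIntegral.integral_of_le (by linarith), integral_Ioc_eq_integral_Ioo]
    _ = ∫ y in Ioo A B, (Ioo c (c + b)).indicator (fun y => b⁻¹ * f ((y - c) / b)) y := by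
        rw [setIntegral_indicator measurableSet_Ioo, Set.inter_eq_right.2 (Ioo_subset_Ioo hA hB)]

/-- **Weierstrass on a general interval.** A continuous `Φ : ℝ → ℝ` with
`∫_{(A,B)} g·Φ = 0` for every real polynomial `g` vanishes on `(A, B)`: translate to `(0, B−A)`
and apply `LinDensity.eq_zero_of_forall_moment_eq_zero` to the moments against `(y − A)^M`.
[folklore] -/
theorem eq_zero_of_forall_setIntegral_polynomial_mul_eq_zero {A B : ℝ} {Φ : ℝ → ℝ}
    (hΦ : Continuous Φ) (horth : ∀ g : Polynomial ℝ, ∫ y in Ioo A B, g.eval y * Φ y = 0)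
    {y : ℝ} (hy : y ∈ Ioo A B) : Φ y = 0 := by
  have hAB : A < B := hy.1.trans hy.2
  have hmom : ∀ M : ℕ, ∫ t in 0..B - A, Φ (t + A) * t ^ M = 0 := by
    intro M
    have h := intervalIntegral.integral_comp_add_right (fun x => Φ x * (x - A) ^ M) A
      (a := 0) (b := B - A)
    simp only [zero_add, sub_add_cancel, add_sub_cancel_right] at h
    rw [h, intervalIntegral.integral_of_le hAB.le, integral_Ioc_eq_integral_Ioo,
      show (fun x => Φ x * (x - A) ^ M) =
          fun x => ((Polynomial.X - Polynomial.C A) ^ M : Polynomial ℝ).eval x * Φ x from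
        funext fun x => by
          simp only [Polynomial.eval_pow, Polynomial.eval_sub, Polynomial.eval_X,
            Polynomial.eval_C, mul_comm]]
    exact horth _
  have h := LinDensity.eq_zero_of_forall_moment_eq_zero (Φ := fun t => Φ (t + A))
    (hΦ.comp (continuous_add_const A)) hmom (y := y - A) ⟨sub_pos.2 hy.1, by linarith [hy.2]⟩
  simpa using h

end GpDensity

open LinDensity GpDensity in
/-- **Stub `stub_gpDensity`** (graph-pencil class `Q = 1 − ϖ(u(z₂) + βz₁)`, step GP2: PUSHFORWARD
DENSITY on the TOP INTERVAL).  Let `u ∈ ℚ[s]` be strictly increasing on `[0,1]` (as a real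
function `U`), `0 < β`, and suppose every polynomial test function of `T(z) = U(z₂) + βz₁`
integrates to zero against `P` on `(0,1)²`.  Then for every `s ∈ (0,1)` with `U(1) − β < U(s)`,
`∫_{σ ∈ (s,1)} P((U(s) + β − U(σ))/β, σ) dσ = 0`.  Indeed the density of `T_*(P dz)` is
`Φ(y) = β⁻¹ ∫_{e(y−β)}^{e(y)} P((y − U(σ))/β, σ) dσ` (`e` the clamped inverse of `U|[0,1]`,
`GpDensity.exists_extendedInverse`; affine substitution `y = U(σ) + βz₁` at fixed `σ`, then
Fubini), a continuous function on `ℝ` orthogonal to all polynomials on `(U(0), U(1)+β)`, hence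
zero there (Weierstrass); at `y = U(s) + β ∈ (U(0), U(1)+β)` the endpoints are `e(U(s)) = s` and
`e(U(s)+β) = 1`. [cite: KontsevichZagier2001, §1.2] -/
theorem stub_gpDensity (u : Polynomial ℚ) (β : ℚ) (P : MvPolynomial (Fin 2) ℚ) (hβ : 0 < β)
    (hmono : StrictMonoOn (fun s : ℝ => Polynomial.aeval s u) (Icc (0 : ℝ) 1))
    (htest : ∀ g : Polynomial ℝ, ∫ z in Set.pi Set.univ (fun _ : Fin 2 => Ioo (0 : ℝ) 1),
      g.eval (Polynomial.aeval (z 1) u + β * z 0) * aeval z P = 0) :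
    ∀ s ∈ Ioo (0 : ℝ) 1, Polynomial.aeval 1 u - β < Polynomial.aeval s u →
      ∫ σ in Ioo s 1, aeval (![(Polynomial.aeval s u + β - Polynomial.aeval σ u) / β, σ] : Fin 2 → ℝ) P = 0 := by
  have hb : (0 : ℝ) < β := by exact_mod_cast hβ
  set b : ℝ := (β : ℝ) with hb_def
  -- the real polynomial function `U = u(·)` and its clamped inverse `e`
  obtain ⟨U, hU⟩ : ∃ U : ℝ → ℝ, ∀ s, U s = Polynomial.aeval s u := ⟨_, fun _ => rfl⟩
  simp only [← hU] at hmono htest ⊢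
  have hU_cont : Continuous U := by
    rw [show U = fun s => Polynomial.aeval s u from funext hU]
    exact Polynomial.continuous_aeval u
  have h01 : (0 : ℝ) ∈ Icc (0 : ℝ) 1 := left_mem_Icc.2 zero_le_one
  have h11 : (1 : ℝ) ∈ Icc (0 : ℝ) 1 := right_mem_Icc.2 zero_le_one
  obtain ⟨e, he_cont, he_mono, he_mem, he_U, he_one, he_iff⟩ := exists_extendedInverse hU_cont hmono
  -- the density integrand `ψ y σ = P((y − U σ)/b, σ)` and the density `Φ` of `T_*(P dz)`
  obtain ⟨ψ, hψ_def⟩ : ∃ ψ : ℝ → ℝ → ℝ, ψ = fun y σ => aeval ![(y - U σ) / b, σ] P := ⟨_, rfl⟩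
  have hψ_cont : Continuous (Function.uncurry ψ) := by
    rw [hψ_def]
    exact (continuous_aeval_real P).comp (continuous_vec_two
      ((continuous_fst.sub (hU_cont.comp continuous_snd)).div_const b) continuous_snd)
  obtain ⟨Φ, hΦ_def⟩ : ∃ Φ : ℝ → ℝ, Φ = fun y => b⁻¹ * ∫ σ in e (y - b)..e y, ψ y σ := ⟨_, rfl⟩
  have hΦ_cont : Continuous Φ := by
    have hI : ∀ y v w, IntervalIntegrable (ψ y) volume v w := fun y v w =>
      (hψ_cont.uncurry_left y).intervalIntegrable v w
    have h : Φ = fun y =>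
        b⁻¹ * ((∫ σ in (0 : ℝ)..e y, ψ y σ) - ∫ σ in (0 : ℝ)..e (y - b), ψ y σ) := by
      rw [hΦ_def]
      funext y
      rw [intervalIntegral.integral_interval_sub_left (hI y _ _) (hI y _ _)]
    rw [h]
    exact continuous_const.mul
      ((intervalIntegral.continuous_parametric_intervalIntegral_of_continuous hψ_cont he_cont).sub
        (intervalIntegral.continuous_parametric_intervalIntegral_of_continuous hψ_cont
          (he_cont.comp (continuous_sub_right b))))
  -- `Φ` is orthogonal to every polynomial on `(U 0, U 1 + b)`
  have horth : ∀ g : Polynomial ℝ, ∫ y in Ioo (U 0) (U 1 + b), g.eval y * Φ y = 0 := by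
    intro g
    -- (i) the square integral as an iterated integral, `σ = z 1` outside
    have h1 : ∫ σ in Ioo (0 : ℝ) 1, ∫ x in Ioo (0 : ℝ) 1,
        g.eval (U σ + b * x) * aeval ![x, σ] P = 0 := by
      have h := htest g
      rw [setIntegral_pi_Ioo_fin_two] at h
      simp only [Matrix.cons_val_zero, Matrix.cons_val_one] at h
      have hGc : Continuous fun p : ℝ × ℝ => g.eval (U p.2 + b * p.1) * aeval ![p.1, p.2] P :=
        (g.continuous.comp ((hU_cont.comp continuous_snd).add
          (continuous_const.mul continuous_fst))).mul
          ((continuous_aeval_real P).comp (continuous_vec_two continuous_fst continuous_snd))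
      rwa [setIntegral_Ioo_prod_Ioo_symm _ hGc] at h
    -- the integrand after the substitution `y = U σ + b x` and zero-extension in `y`
    obtain ⟨F, hF_def⟩ : ∃ F : ℝ × ℝ → ℝ, F = ({p : ℝ × ℝ | U p.1 < p.2} ∩
        {p | p.2 < U p.1 + b}).indicator (fun p => b⁻¹ * (g.eval p.2 * ψ p.2 p.1)) := ⟨_, rfl⟩
    -- (ii) substitution in the inner integral
    have h2 : ∫ σ in Ioo (0 : ℝ) 1, ∫ y in Ioo (U 0) (U 1 + b), F (σ, y) = 0 := by
      refine Eq.trans (setIntegral_congr_fun measurableSet_Ioo fun σ hσ => ?_) h1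
      have hσ' : σ ∈ Icc (0 : ℝ) 1 := Ioo_subset_Icc_self hσ
      have hAc : U 0 ≤ U σ := hmono.monotoneOn h01 hσ' hσ'.1
      have hcB : U σ + b ≤ U 1 + b := by linarith [hmono.monotoneOn hσ' h11 hσ'.2]
      rw [setIntegral_Ioo_unit_comp_affine (fun x => g.eval (U σ + b * x) * aeval ![x, σ] P)
        hb (U σ) hAc hcB]
      refine setIntegral_congr_fun measurableSet_Ioo fun y _ => ?_
      have hy' : U σ + b * ((y - U σ) / b) = y := by field_simp; ring
      simp only [hF_def, hψ_def, Set.indicator_apply, mem_inter_iff, mem_setOf_eq, mem_Ioo, hy']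
    -- (iii) Fubini
    have hF_int : IntegrableOn F (Ioo (0 : ℝ) 1 ×ˢ Ioo (U 0) (U 1 + b)) volume := by
      rw [hF_def]
      refine Integrable.indicator ?_
        ((measurableSet_lt (hU_cont.measurable.comp measurable_fst) measurable_snd).inter
          (measurableSet_lt measurable_snd
            ((hU_cont.measurable.comp measurable_fst).add_const b)))
      have hGc : Continuous fun p : ℝ × ℝ => b⁻¹ * (g.eval p.2 * ψ p.2 p.1) :=
        continuous_const.mul ((g.continuous.comp continuous_snd).mul
          (hψ_cont.comp (continuous_snd.prodMk continuous_fst)))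
      exact (hGc.continuousOn.integrableOn_compact (isCompact_Icc.prod isCompact_Icc)).mono_set
        (Set.prod_mono Ioo_subset_Icc_self Ioo_subset_Icc_self)
    have h3 : ∫ y in Ioo (U 0) (U 1 + b), ∫ σ in Ioo (0 : ℝ) 1, F (σ, y) = 0 := by
      rw [← setIntegral_setIntegral_swap F hF_int]
      exact h2
    -- (iv) the inner integral is `g y · Φ y`
    refine Eq.trans (setIntegral_congr_fun measurableSet_Ioo fun y _ => ?_) h3
    have hind : ∀ σ, F (σ, y) = ({σ : ℝ | U σ < y} ∩ {σ | y < U σ + b}).indicator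
        (fun σ => b⁻¹ * (g.eval y * ψ y σ)) σ := by
      intro σ
      simp only [hF_def, Set.indicator_apply, mem_inter_iff, mem_setOf_eq]
    have hset :
        Ioo (0 : ℝ) 1 ∩ ({σ : ℝ | U σ < y} ∩ {σ | y < U σ + b}) = Ioo (e (y - b)) (e y) := by
      ext σ
      simp only [mem_inter_iff, mem_Ioo, mem_setOf_eq]
      constructor
      · rintro ⟨hσ, hlt, hgt⟩
        exact ⟨((he_iff σ hσ (y - b)).2).1 (by linarith), ((he_iff σ hσ y).1).1 hlt⟩
      · rintro ⟨hl, hr⟩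
        have hσ : σ ∈ Ioo (0 : ℝ) 1 := ⟨(he_mem _).1.trans_lt hl, hr.trans_le (he_mem _).2⟩
        exact ⟨hσ, ((he_iff σ hσ y).1).2 hr, by linarith [((he_iff σ hσ (y - b)).2).2 hl]⟩
    simp_rw [hind]
    rw [setIntegral_indicator ((measurableSet_lt hU_cont.measurable measurable_const).inter
      (measurableSet_lt measurable_const (hU_cont.measurable.add_const b))), hset,
      integral_const_mul, integral_const_mul, hΦ_def]
    simp only
    rw [intervalIntegral.integral_of_le (he_mono (by linarith)), integral_Ioc_eq_integral_Ioo]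
    ring
  -- Weierstrass: `Φ` vanishes on `(U 0, U 1 + b)`; unfold it at `y = U s + b`
  intro s hs hlt
  have hs' : s ∈ Icc (0 : ℝ) 1 := Ioo_subset_Icc_self hs
  have hy : U s + b ∈ Ioo (U 0) (U 1 + b) :=
    ⟨by linarith [hmono h01 hs' hs.1], by linarith [hmono hs' h11 hs.2]⟩
  have hΦy := eq_zero_of_forall_setIntegral_polynomial_mul_eq_zero hΦ_cont horth hy
  rw [hΦ_def] at hΦy
  simp only [add_sub_cancel_right] at hΦy
  rw [he_U s hs', he_one _ (by linarith), intervalIntegral.integral_of_le hs.2.le,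
    integral_Ioc_eq_integral_Ioo, hψ_def] at hΦy
  exact (mul_eq_zero.1 hΦy).resolve_left (inv_ne_zero hb.ne')

end Summit.KontsevichZagierPeriods.InverseLandau.TateFamilyKernel.Descent

end
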